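import Summits.NavierStokesRegularity.NavierStokesRegularity.Theorems.PerpetualPumpAveragedTypeIBlowupDieGlobalCritical
import Summits.NavierStokesRegularity.NavierStokesRegularity.Theorems.PerpetualPumpAveragedTypeIBlowupDieGlobalUnique
import Summits.NavierStokesRegularity.NavierStokesRegularity.Theorems.PerpetualPumpAveragedTypeIBlowupChainContinuation
import Summits.NavierStokesRegularity.NavierStokesRegularity.Theorems.PerpetualPumpAveragedTypeIBlowupKernel

/-!
# Crux `PerpetualPump.AveragedTypeIBlowup` (stmt-NavierStokesRegularity-1835), line `Sketch`:
# the stub `dieGlobal` — critical smallness at one time forces a global solution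

T. Tao, *Finite time blowup for an averaged three-dimensional Navier–Stokes equation*, J. Amer.
Math. Soc. **29** (2016), 601–674 = arXiv:1402.0290v3, §4 p. 22 (4.14) and §5.2 (Prop. 5.1, the
dissipation-dominated regime): the wavelet coefficients of a mild solution of the cascade equation solve
the exact Volterra chain `Y_{i,n}(t) = A 1_{(i,n)=(i₀,n₀)} k_{i,n}(t) + ∫₀ᵗ k_{i,n}(t-s) quadTerm(Y)_{i,n}(s) ds`
with the heat kernels of the modes `k_{i,n}(τ) = Re⟨e^{τΔ}ψ_{i,n}, ψ_{i,n}⟩`, which dissipate at the rate of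
the scale, `0 ≤ k_{i,n}(τ) ≤ e^{-4π²(1+ε₀)^{2n}τ}` (landed `stub_kernel`).

This file proves the registered stub `stub_dieGlobal` of the lead's skeleton
`Cruxes/AveragedTypeIBlowup/Lines/Sketch.lean`, verbatim — the "die" half of the shooting dichotomy:
there is `δ = δ(ε₀, α) > 0` such that a chain solution whose band-Duhamel majorant
`b_{i,n}(t₀) = e^{-4π²(1+ε₀)^{2n}t₀}|A|1 + ∫₀^{t₀}|quadTerm_{i,n}(s)|e^{-4π²(1+ε₀)^{2n}(t₀-s)} ds` is small in
the scale-critical weight at one time, `sup_{i,n}(1+ε₀)^{n/2} b_{i,n}(t₀) ≤ δ`, extends to every `[0,S'')`: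

1. `weight_ten_bound`: by the critical bootstrap of the companion file (`critical_bound`: all modes stay
   critically below `2δ` after `t₀`) and the linear weight-`10` step (`weight_ten_step`), the `H¹⁰` size
   `sup (1+ε₀)^{10n}|Y_{i,n}(t)|` stays bounded on all of `[0,S)` (a supremum argument on each `[0,S']`);
2. `dieGlobal_of_kernel`: hence the solution extends strictly (landed `chainContinuation_of_kernel`),
   and so does every solution agreeing with it (the smallness at `t₀` is inherited); uniqueness and
   gluing (`chain_unique`, `chain_glue`) then reach every `S''`.

Nothing here changes a statement of the route; the file lands with `--supports`.

## References

* T. Tao, J. Amer. Math. Soc. 29 (2016), 601–674, arXiv:1402.0290v3, §4 p. 22 (4.14), §5.2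
  Prop. 5.1. [`Tao2016AveragedNS`]
-/

noncomputable section

-- the summit namespace `…NavierStokesRegularity.NavierStokesRegularity…` is the tree convention
set_option linter.dupNamespace false

open MeasureTheory Set Filter Topology
open scoped ENNReal
open Literature.Analysis.FluidPDE Literature.Analysis.FluidPDE.Tao2016
open Literature.Analysis.FluidPDE.TaoCascade (quadTerm IsSymmetricCoeff IsCancellingCoeff)
open Literature.Analysis.FluidPDE.TaoCascade (shiftSet)

namespace Summit.NavierStokesRegularity.NavierStokesRegularity.Theorems.PerpetualPumpAveragedTypeIBlowup

variable {ε₀ : ℝ} {m : ℕ}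

/-! ### The weight-`10` bound on `[0, S)` -/

/-- **Critical smallness at `t₀` forces the `H¹⁰` bound on all of `[0,S)`.** Let `Y` solve the chain
on `[0,S)` with dissipating kernels `|k| ≤ 1` (continuous, no modes below `n₀`, `(1+ε₀)^{20n}`-bounded
on compact sub-intervals), `0 < ε₀ ≤ 1`, and let `(1+ε₀)^{n/2} b_{i,n}(t₀) ≤ δ` for all modes with
`256Kδ ≤ π²`, `δ > 0`. Then `sup_{i,n,t<S} (1+ε₀)^{10n}|Y_{i,n}(t)| < ∞`. On `[0,t₀]` this is the
compactness hypothesis. On `[t₀,S')`, `S' < S`, let `M` be the supremum of the weight-`10` sizes over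
`[0,S']` (finite by hypothesis); by `critical_bound` and `weight_ten_step` every such size is at most
`max(B₀, B + M/2)` with `B₀`, `B` independent of `S'` (`B` bounds the weight-`10` size of the memory),
so `M ≤ max(B₀, 2B)`. [cite: Tao2016AveragedNS, §5.2] -/
theorem weight_ten_bound (hε₀ : 0 < ε₀) (hε₁ : ε₀ ≤ 1) (α : Fin m → Fin m → Fin m → ℤ × ℤ × ℤ → ℝ)
    {K : ℝ} (hK : ∀ i : Fin m, (∑ i₁ : Fin m, ∑ i₂ : Fin m, ∑ μ ∈ shiftSet, |α i₁ i₂ i μ|) ≤ K)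
    (k : Fin m → ℤ → ℝ → ℝ) (hk0 : ∀ i n τ, 0 ≤ τ → 0 ≤ k i n τ)
    (hk1 : ∀ (i : Fin m) (n : ℤ) (τ : ℝ), 0 ≤ τ →
      k i n τ ≤ Real.exp (-(4 * Real.pi ^ 2 * (1 + ε₀) ^ (2 * n) * τ)))
    (hka : ∀ i n τ, |k i n τ| ≤ 1) (hkc : ∀ i n, Continuous (k i n)) (i₀ : Fin m) (n₀ : ℤ)
    (A S : ℝ) (Y : Fin m → ℤ → ℝ → ℝ) (hcont : ∀ i n, ContinuousOn (Y i n) (Ico 0 S))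
    (hlow : ∀ i n t, n < n₀ → Y i n t = 0)
    (hdec : ∀ S' : ℝ, S' < S → ∃ C : ℝ, ∀ (i : Fin m) (n : ℤ), ∀ t ∈ Icc 0 S',
      (1 + ε₀) ^ ((20 : ℝ) * n) * |Y i n t| ≤ C)
    (hchain : ∀ (i : Fin m) (n : ℤ), ∀ t ∈ Ico 0 S,
      Y i n t = (if i = i₀ ∧ n = n₀ then A else 0) * k i n t +
        ∫ s in (0 : ℝ)..t, k i n (t - s) * quadTerm ε₀ α Y i n s)
    {δ : ℝ} (hδ0 : 0 < δ) (hKδ : 256 * K * δ ≤ Real.pi ^ 2) {t₀ : ℝ} (ht₀ : t₀ ∈ Ico 0 S)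
    (hsmall : ∀ (i : Fin m) (n : ℤ), (1 + ε₀) ^ ((n : ℝ) / 2) *
      (Real.exp (-(4 * Real.pi ^ 2 * (1 + ε₀) ^ (2 * n) * t₀)) * (if i = i₀ ∧ n = n₀ then |A| else 0) +
        ∫ s in (0 : ℝ)..t₀, |quadTerm ε₀ α Y i n s| *
          Real.exp (-(4 * Real.pi ^ 2 * (1 + ε₀) ^ (2 * n) * (t₀ - s)))) ≤ δ) :
    ∃ C : ℝ, ∀ (i : Fin m) (n : ℤ), ∀ t ∈ Ico 0 S, (1 + ε₀) ^ ((10 : ℝ) * n) * |Y i n t| ≤ C := by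
  have hL0 : 0 < 1 + ε₀ := by linarith
  have hL1 : 1 ≤ 1 + ε₀ := by linarith
  have hK0 : 0 ≤ K := le_trans (by positivity) (hK i₀)
  have hKδ' : 2 * K * δ ≤ Real.pi ^ 2 := le_trans (by nlinarith) hKδ
  have hcrit := critical_bound hε₀ α hK k hk0 hk1 hkc i₀ n₀ A S Y hcont hlow hdec hchain hδ0 hKδ' ht₀
    hsmall
  -- the weight-`20` bound on `[0, t₀]` and the two constants
  obtain ⟨C₀, hC₀⟩ := hdec t₀ ht₀.2
  have hC₀0 : 0 ≤ C₀ :=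
    le_trans (mul_nonneg (Real.rpow_nonneg hL0.le _) (abs_nonneg _)) (hC₀ i₀ n₀ 0 ⟨le_rfl, ht₀.1⟩)
  set B₀ : ℝ := (1 + ε₀) ^ (-(10 : ℝ) * n₀) * C₀ with hB₀
  have hB₀0 : 0 ≤ B₀ := by positivity
  have hwt : ∀ n : ℤ, n₀ ≤ n →
      (1 + ε₀) ^ ((10 : ℝ) * n) ≤ (1 + ε₀) ^ (-(10 : ℝ) * n₀) * (1 + ε₀) ^ ((20 : ℝ) * n) := by
    intro n hn
    rw [← Real.rpow_add hL0]
    refine Real.rpow_le_rpow_of_exponent_le hL1 ?_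
    have hn' : (n₀ : ℝ) ≤ n := by exact_mod_cast hn
    linarith
  have hB₀b : ∀ (i : Fin m) (n : ℤ), ∀ t ∈ Icc 0 t₀, (1 + ε₀) ^ ((10 : ℝ) * n) * |Y i n t| ≤ B₀ := by
    intro i n t ht
    rcases lt_or_ge n n₀ with hn | hn
    · rw [hlow i n t hn, abs_zero, mul_zero]
      exact hB₀0
    calc (1 + ε₀) ^ ((10 : ℝ) * n) * |Y i n t|
        ≤ (1 + ε₀) ^ (-(10 : ℝ) * n₀) * (1 + ε₀) ^ ((20 : ℝ) * n) * |Y i n t| :=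
          mul_le_mul_of_nonneg_right (hwt n hn) (abs_nonneg _)
      _ ≤ (1 + ε₀) ^ (-(10 : ℝ) * n₀) * C₀ := by
          rw [mul_assoc]
          exact mul_le_mul_of_nonneg_left (hC₀ i n t ht) (Real.rpow_nonneg hL0.le _)
  set B : ℝ := (1 + ε₀) ^ ((10 : ℝ) * n₀) * |A| +
    S * (K * (2 * C₀ * C₀) * (1 + ε₀) ^ ((75 : ℝ) / 2 - 55 / 2 * n₀)) with hB
  -- the weight-`10` size of the memory after `t₀`
  have hBb : ∀ (i : Fin m) (n : ℤ), n₀ ≤ n → ∀ t : ℝ, (1 + ε₀) ^ ((10 : ℝ) * n) *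
      |(if i = i₀ ∧ n = n₀ then A else 0) * k i n t +
        ∫ s in (0 : ℝ)..t₀, k i n (t - s) * quadTerm ε₀ α Y i n s| ≤ B := by
    intro i n hn t
    have h1 : (1 + ε₀) ^ ((10 : ℝ) * n) * |(if i = i₀ ∧ n = n₀ then A else 0) * k i n t| ≤
        (1 + ε₀) ^ ((10 : ℝ) * n₀) * |A| := by
      split_ifs with h
      · rw [abs_mul, h.2]
        calc (1 + ε₀) ^ ((10 : ℝ) * n₀) * (|A| * |k i n₀ t|)
            ≤ (1 + ε₀) ^ ((10 : ℝ) * n₀) * (|A| * 1) := by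
              gcongr
              exact hka i n₀ t
          _ = _ := by ring
      · rw [zero_mul, abs_zero, mul_zero]
        positivity
    have hint := intervalIntegral.norm_integral_le_of_norm_le_const (a := 0) (b := t₀)
      (C := (∑ i₁ : Fin m, ∑ i₂ : Fin m, ∑ μ ∈ shiftSet, |α i₁ i₂ i μ|) * (2 * C₀ * C₀) *
        (1 + ε₀) ^ ((2 * 20 - 5 / 2 : ℝ) * (1 - n)))
      (f := fun s => k i n (t - s) * quadTerm ε₀ α Y i n s) fun s hs => by
        rw [uIoc_of_le ht₀.1] at hs
        rw [Real.norm_eq_abs, abs_mul]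
        calc |k i n (t - s)| * |quadTerm ε₀ α Y i n s|
            ≤ 1 * ((∑ i₁ : Fin m, ∑ i₂ : Fin m, ∑ μ ∈ shiftSet, |α i₁ i₂ i μ|) * (2 * C₀ * C₀) *
                (1 + ε₀) ^ ((2 * 20 - 5 / 2 : ℝ) * (1 - n))) :=
              mul_le_mul (hka _ _ _) (abs_quadTerm_le_of_weight hε₀ (by norm_num) α hC₀0
                (fun j k' => (weight_mul_abs_le_iff hL0 _ _ _).1 (hC₀ j k' s ⟨hs.1.le, hs.2⟩)) i n)
                (abs_nonneg _) zero_le_one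
          _ = _ := one_mul _
    rw [Real.norm_eq_abs, sub_zero, abs_of_nonneg ht₀.1] at hint
    have hexp : (1 + ε₀) ^ ((10 : ℝ) * n) * (1 + ε₀) ^ ((2 * 20 - 5 / 2 : ℝ) * (1 - n)) ≤
        (1 + ε₀) ^ ((75 : ℝ) / 2 - 55 / 2 * n₀) := by
      rw [← Real.rpow_add hL0]
      refine Real.rpow_le_rpow_of_exponent_le hL1 ?_
      have hn' : (n₀ : ℝ) ≤ n := by exact_mod_cast hn
      linarith
    have h2 : (1 + ε₀) ^ ((10 : ℝ) * n) * |∫ s in (0 : ℝ)..t₀, k i n (t - s) * quadTerm ε₀ α Y i n s| ≤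
        S * (K * (2 * C₀ * C₀) * (1 + ε₀) ^ ((75 : ℝ) / 2 - 55 / 2 * n₀)) := by
      calc (1 + ε₀) ^ ((10 : ℝ) * n) * |∫ s in (0 : ℝ)..t₀, k i n (t - s) * quadTerm ε₀ α Y i n s|
          ≤ (1 + ε₀) ^ ((10 : ℝ) * n) * ((∑ i₁ : Fin m, ∑ i₂ : Fin m, ∑ μ ∈ shiftSet, |α i₁ i₂ i μ|) *
              (2 * C₀ * C₀) * (1 + ε₀) ^ ((2 * 20 - 5 / 2 : ℝ) * (1 - n)) * t₀) :=
            mul_le_mul_of_nonneg_left hint (Real.rpow_nonneg hL0.le _)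
        _ = ((1 + ε₀) ^ ((10 : ℝ) * n) * (1 + ε₀) ^ ((2 * 20 - 5 / 2 : ℝ) * (1 - n))) *
              ((∑ i₁ : Fin m, ∑ i₂ : Fin m, ∑ μ ∈ shiftSet, |α i₁ i₂ i μ|) * (2 * C₀ * C₀)) * t₀ := by
            ring
        _ ≤ (1 + ε₀) ^ ((75 : ℝ) / 2 - 55 / 2 * n₀) * (K * (2 * C₀ * C₀)) * S :=
            mul_le_mul (mul_le_mul hexp (mul_le_mul_of_nonneg_right (hK i) (by positivity))
              (by positivity) (Real.rpow_nonneg hL0.le _)) ht₀.2.le ht₀.1 (by positivity)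
        _ = _ := by ring
    calc (1 + ε₀) ^ ((10 : ℝ) * n) * |(if i = i₀ ∧ n = n₀ then A else 0) * k i n t +
          ∫ s in (0 : ℝ)..t₀, k i n (t - s) * quadTerm ε₀ α Y i n s|
        ≤ (1 + ε₀) ^ ((10 : ℝ) * n) * (|(if i = i₀ ∧ n = n₀ then A else 0) * k i n t| +
            |∫ s in (0 : ℝ)..t₀, k i n (t - s) * quadTerm ε₀ α Y i n s|) :=
          mul_le_mul_of_nonneg_left (abs_add_le _ _) (Real.rpow_nonneg hL0.le _)
      _ ≤ _ := by rw [mul_add]; exact add_le_add h1 h2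
  have hB0 : 0 ≤ B :=
    le_trans (mul_nonneg (Real.rpow_nonneg hL0.le _) (abs_nonneg _)) (hBb i₀ n₀ le_rfl t₀)
  -- the bound
  refine ⟨max B₀ (2 * B), fun i n t ht => ?_⟩
  rcases le_or_gt t t₀ with htt₀ | htt₀
  · exact (hB₀b i n t ⟨ht.1, htt₀⟩).trans (le_max_left _ _)
  -- the supremum of the weight-`10` sizes over `[0, t]`
  obtain ⟨Ct, hCt⟩ := hdec t ht.2
  set V : Set ℝ := {x | ∃ (j : Fin m) (k' : ℤ) (s : ℝ), s ∈ Icc 0 t ∧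
    x = (1 + ε₀) ^ ((10 : ℝ) * k') * |Y j k' s|} with hV
  have hVbdd : BddAbove V := by
    refine ⟨max 0 ((1 + ε₀) ^ (-(10 : ℝ) * n₀) * Ct), ?_⟩
    rintro x ⟨j, k', s, hs, rfl⟩
    rcases lt_or_ge k' n₀ with hk' | hk'
    · rw [hlow j k' s hk', abs_zero, mul_zero]
      exact le_max_left _ _
    refine le_max_of_le_right ?_
    calc (1 + ε₀) ^ ((10 : ℝ) * k') * |Y j k' s|
        ≤ (1 + ε₀) ^ (-(10 : ℝ) * n₀) * (1 + ε₀) ^ ((20 : ℝ) * k') * |Y j k' s| :=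
          mul_le_mul_of_nonneg_right (hwt k' hk') (abs_nonneg _)
      _ ≤ (1 + ε₀) ^ (-(10 : ℝ) * n₀) * Ct := by
          rw [mul_assoc]
          exact mul_le_mul_of_nonneg_left (hCt j k' s hs) (Real.rpow_nonneg hL0.le _)
  have hVne : V.Nonempty := ⟨_, i, n, t, ⟨ht.1, le_rfl⟩, rfl⟩
  have hMub : ∀ (j : Fin m) (k' : ℤ) (s : ℝ), s ∈ Icc 0 t →
      (1 + ε₀) ^ ((10 : ℝ) * k') * |Y j k' s| ≤ sSup V := fun j k' s hs =>
    le_csSup hVbdd ⟨j, k', s, hs, rfl⟩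
  have hM0 : 0 ≤ sSup V :=
    le_trans (mul_nonneg (Real.rpow_nonneg hL0.le _) (abs_nonneg _)) (hMub i n t ⟨ht.1, le_rfl⟩)
  have hMle : sSup V ≤ max B₀ (B + sSup V / 2) := by
    refine csSup_le hVne ?_
    rintro x ⟨j, k', s, hs, rfl⟩
    rcases le_or_gt s t₀ with hst₀ | hst₀
    · exact (hB₀b j k' s ⟨hs.1, hst₀⟩).trans (le_max_left _ _)
    refine le_trans ?_ (le_max_right _ _)
    rcases lt_or_ge k' n₀ with hk' | hk'
    · rw [hlow j k' s hk', abs_zero, mul_zero]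
      linarith
    have hsS : s < S := hs.2.trans_lt ht.2
    have hstep := weight_ten_step hε₀ hε₁ α hK k hk0 hk1 hkc hcont i₀ n₀ A hchain hδ0.le hKδ ht₀.1
      hst₀.le hsS (fun s' hs' j' k'' => hcrit s' ⟨hs'.1, hs'.2.trans_lt hsS⟩ j' k'') hM0
      (fun s' hs' j' k'' => hMub j' k'' s' ⟨ht₀.1.trans hs'.1, hs'.2.trans hs.2⟩) j k'
    linarith [hBb j k' hk' s]
  have hMfin : sSup V ≤ max B₀ (2 * B) := by
    rcases le_total B₀ (B + sSup V / 2) with h | h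
    · rw [max_eq_right h] at hMle
      exact le_max_of_le_right (by linarith)
    · rw [max_eq_left h] at hMle
      exact le_max_of_le_left hMle
  exact (hMub i n t ⟨ht.1, le_rfl⟩).trans hMfin

/-! ### Globalization -/

/-- The band-Duhamel integral `∫₀^{t₀} |quadTerm_{i,n}(s)| e^{-c(t₀-s)} ds` only sees the coefficients
on `[0,t₀]`. [folklore] -/
theorem integral_abs_quadTerm_congr (α : Fin m → Fin m → Fin m → ℤ × ℤ × ℤ → ℝ)
    {Y Y' : Fin m → ℤ → ℝ → ℝ} {T t₀ : ℝ} (ht₀ : t₀ ∈ Ico 0 T)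
    (h : ∀ (i : Fin m) (n : ℤ), ∀ t ∈ Ico 0 T, Y' i n t = Y i n t) (i : Fin m) (n : ℤ) (c : ℝ) :
    ∫ s in (0 : ℝ)..t₀, |quadTerm ε₀ α Y' i n s| * Real.exp (-(c * (t₀ - s))) =
      ∫ s in (0 : ℝ)..t₀, |quadTerm ε₀ α Y i n s| * Real.exp (-(c * (t₀ - s))) :=
  intervalIntegral.integral_congr fun s hs => by
    rw [uIcc_of_le ht₀.1] at hs
    show |quadTerm ε₀ α Y' i n s| * Real.exp (-(c * (t₀ - s))) =
      |quadTerm ε₀ α Y i n s| * Real.exp (-(c * (t₀ - s)))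
    rw [quadTerm_congr_at α (fun j k' => h j k' s ⟨hs.1, hs.2.trans_lt ht₀.2⟩) i n]

/-- **Critical smallness at one time forces a global solution (general dissipating kernels).** For
continuous kernels `0 ≤ k_{i,n}(τ) ≤ e^{-4π²(1+ε₀)^{2n}τ}` (`τ ≥ 0`), `|k_{i,n}| ≤ 1`, and
`δ = π²/(256(K+1))`, `K = Σ|α|`: every continuous solution of the chain on `[0,S)` (no modes below `n₀`,
`(1+ε₀)^{20n}`-bounded on compact sub-intervals) whose band-Duhamel majorant is critically `δ`-small at
some `t₀ < S` extends to every `[0,S'')`, `S'' ≥ S`. Otherwise the lifespans `T ∈ [S, S'')` of the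
solutions form a nonempty bounded set; the solutions glue to one on `[0, sup)` (`chain_glue`), which
agrees with `Y` on `[0,S)` (`chain_unique`), is therefore still critically small at `t₀`, hence
`H¹⁰`-bounded on `[0, sup)` (`weight_ten_bound`) and extends past `sup` (`chainContinuation_of_kernel`)
— a contradiction. [cite: Tao2016AveragedNS, §5.2 Prop. 5.1] -/
theorem dieGlobal_of_kernel (hε₀ : 0 < ε₀) (hε₁ : ε₀ ≤ 1)
    (α : Fin m → Fin m → Fin m → ℤ × ℤ × ℤ → ℝ) (k : Fin m → ℤ → ℝ → ℝ)
    (hk0 : ∀ i n τ, 0 ≤ τ → 0 ≤ k i n τ)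
    (hk1 : ∀ (i : Fin m) (n : ℤ) (τ : ℝ), 0 ≤ τ →
      k i n τ ≤ Real.exp (-(4 * Real.pi ^ 2 * (1 + ε₀) ^ (2 * n) * τ)))
    (hka : ∀ i n τ, |k i n τ| ≤ 1) (hkc : ∀ i n, Continuous (k i n)) (n₀ : ℤ) :
    ∃ δ : ℝ, 0 < δ ∧ ∀ (i₀ : Fin m) (A S : ℝ) (Y : Fin m → ℤ → ℝ → ℝ), 0 < S →
      (∀ i n, ContinuousOn (Y i n) (Ico 0 S)) →
      (∀ i n t, n < n₀ → Y i n t = 0) →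
      (∀ S' : ℝ, S' < S → ∃ C : ℝ, ∀ (i : Fin m) (n : ℤ), ∀ t ∈ Icc 0 S',
        (1 + ε₀) ^ ((20 : ℝ) * n) * |Y i n t| ≤ C) →
      (∀ (i : Fin m) (n : ℤ), ∀ t ∈ Ico 0 S,
        Y i n t = (if i = i₀ ∧ n = n₀ then A else 0) * k i n t +
          ∫ s in (0 : ℝ)..t, k i n (t - s) * quadTerm ε₀ α Y i n s) →
      (∃ t₀ ∈ Ico 0 S, ∀ (i : Fin m) (n : ℤ),
        (1 + ε₀) ^ ((n : ℝ) / 2) *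
          (Real.exp (-(4 * Real.pi ^ 2 * (1 + ε₀) ^ (2 * n) * t₀)) * (if i = i₀ ∧ n = n₀ then |A| else 0) +
            ∫ s in (0 : ℝ)..t₀, |quadTerm ε₀ α Y i n s| *
              Real.exp (-(4 * Real.pi ^ 2 * (1 + ε₀) ^ (2 * n) * (t₀ - s)))) ≤ δ) →
      ∀ S'' : ℝ, S ≤ S'' → ∃ Y'' : Fin m → ℤ → ℝ → ℝ,
        (∀ i n, ContinuousOn (Y'' i n) (Ico 0 S'')) ∧
        (∀ i n t, n < n₀ → Y'' i n t = 0) ∧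
        (∀ S' : ℝ, S' < S'' → ∃ C : ℝ, ∀ (i : Fin m) (n : ℤ), ∀ t ∈ Icc 0 S',
          (1 + ε₀) ^ ((20 : ℝ) * n) * |Y'' i n t| ≤ C) ∧
        (∀ (i : Fin m) (n : ℤ), ∀ t ∈ Ico 0 S'',
          Y'' i n t = (if i = i₀ ∧ n = n₀ then A else 0) * k i n t +
            ∫ s in (0 : ℝ)..t, k i n (t - s) * quadTerm ε₀ α Y'' i n s) ∧
        ∀ (i : Fin m) (n : ℤ), ∀ t ∈ Ico 0 S, Y'' i n t = Y i n t := by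
  set K : ℝ := ∑ i₃ : Fin m, ∑ i₁ : Fin m, ∑ i₂ : Fin m, ∑ μ ∈ shiftSet, |α i₁ i₂ i₃ μ| with hK
  have hK0 : 0 ≤ K := by positivity
  have hKall : ∀ j : Fin m, (∑ i₁ : Fin m, ∑ i₂ : Fin m, ∑ μ ∈ shiftSet, |α i₁ i₂ j μ|) ≤ K :=
    fun j => coeffSum_le α j
  clear_value K
  refine ⟨Real.pi ^ 2 / (256 * (K + 1)), by positivity, ?_⟩
  set δ : ℝ := Real.pi ^ 2 / (256 * (K + 1)) with hδ
  have hδ0 : 0 < δ := by positivity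
  have hKδ : 256 * K * δ ≤ Real.pi ^ 2 := by
    rw [hδ, ← mul_div_assoc, div_le_iff₀ (by positivity)]
    nlinarith [Real.pi_pos, sq_nonneg Real.pi]
  clear_value δ
  intro i₀ A S Y hS hcont hlow hdec hchain hsm S'' hSS''
  obtain ⟨t₀, ht₀, hsmall⟩ := hsm
  by_contra hcon
  -- the lifespans below `S''` of the solutions (they all agree with `Y` on `[0, S)`)
  set 𝒯 : Set ℝ := {T | S ≤ T ∧ ∃ Y' : Fin m → ℤ → ℝ → ℝ,
    (∀ i n, ContinuousOn (Y' i n) (Ico 0 T)) ∧ (∀ i n t, n < n₀ → Y' i n t = 0) ∧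
    (∀ S' : ℝ, S' < T → ∃ C : ℝ, ∀ (i : Fin m) (n : ℤ), ∀ t ∈ Icc 0 S',
      (1 + ε₀) ^ ((20 : ℝ) * n) * |Y' i n t| ≤ C) ∧
    (∀ (i : Fin m) (n : ℤ), ∀ t ∈ Ico 0 T,
      Y' i n t = (if i = i₀ ∧ n = n₀ then A else 0) * k i n t +
        ∫ s in (0 : ℝ)..t, k i n (t - s) * quadTerm ε₀ α Y' i n s)} with h𝒯
  have hlt : ∀ T ∈ 𝒯, T < S'' := by
    rintro T ⟨hST, Y', hc, hl, hd, hch⟩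
    by_contra h
    push Not at h
    exact hcon ⟨Y', fun i n => (hc i n).mono (Ico_subset_Ico_right h), hl,
      fun S' hS' => hd S' (hS'.trans_le h), fun i n t ht => hch i n t ⟨ht.1, ht.2.trans_le h⟩,
      fun i n t ht => chain_unique hε₀ α k hka hkc i₀ n₀ A hc hl hd hch hcont hlow hdec hchain i n t
        ⟨ht.1, lt_min (ht.2.trans_le hST) ht.2⟩⟩
  have hS𝒯 : S ∈ 𝒯 := ⟨le_rfl, Y, hcont, hlow, hdec, hchain⟩
  have hne : 𝒯.Nonempty := ⟨S, hS𝒯⟩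
  have hbdd : BddAbove 𝒯 := ⟨S'', fun T hT => (hlt T hT).le⟩
  have hST₁ : S ≤ sSup 𝒯 := le_csSup hbdd hS𝒯
  -- the glued solution on `[0, sup 𝒯)`; it agrees with `Y` on `[0, S)` and is small at `t₀`
  obtain ⟨Yg, hgcont, hglow, hgdec, hgchain⟩ :=
    chain_glue hε₀ α k hka hkc i₀ n₀ A hne fun T hT => hT.2
  have hgY : ∀ (i : Fin m) (n : ℤ), ∀ t ∈ Ico 0 S, Yg i n t = Y i n t := fun i n t ht =>
    chain_unique hε₀ α k hka hkc i₀ n₀ A hgcont hglow hgdec hgchain hcont hlow hdec hchain i n t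
      ⟨ht.1, lt_min (ht.2.trans_le hST₁) ht.2⟩
  have ht₀' : t₀ ∈ Ico 0 (sSup 𝒯) := ⟨ht₀.1, ht₀.2.trans_le hST₁⟩
  have hsmallg : ∀ (i : Fin m) (n : ℤ), (1 + ε₀) ^ ((n : ℝ) / 2) *
      (Real.exp (-(4 * Real.pi ^ 2 * (1 + ε₀) ^ (2 * n) * t₀)) * (if i = i₀ ∧ n = n₀ then |A| else 0) +
        ∫ s in (0 : ℝ)..t₀, |quadTerm ε₀ α Yg i n s| *
          Real.exp (-(4 * Real.pi ^ 2 * (1 + ε₀) ^ (2 * n) * (t₀ - s)))) ≤ δ := fun i n => by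
    rw [integral_abs_quadTerm_congr α ht₀ hgY i n]
    exact hsmall i n
  -- hence it is `H¹⁰`-bounded and extends past `sup 𝒯`: a contradiction
  obtain ⟨C, hC⟩ := weight_ten_bound hε₀ hε₁ α hKall k hk0 hk1 hka hkc i₀ n₀ A (sSup 𝒯) Yg hgcont
    hglow hgdec hgchain hδ0 hKδ ht₀' hsmallg
  obtain ⟨T', Y'', hT', hc'', hl'', hd'', hch'', -⟩ := chainContinuation_of_kernel hε₀ α k hka
    hkc i₀ n₀ A (sSup 𝒯) Yg (hS.trans_le hST₁) hgcont hglow hgchain ⟨C, hC⟩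
  have hT'𝒯 : T' ∈ 𝒯 := ⟨hST₁.trans hT'.le, Y'', hc'', hl'', hd'', hch''⟩
  exact (lt_irrefl _) (hT'.trans_le (le_csSup hbdd hT'𝒯))

/-! ### The registered stub -/

/-- **Stub `dieGlobal`** (registered stub of the line `Sketch` of the crux
`PerpetualPump.AveragedTypeIBlowup`, verbatim): the "die" half of the shooting dichotomy for the exact
Volterra chain of the wavelet coefficients, `Y_{i,n}(t) = A 1_{(i,n)=(i₀,n₀)} k_{i,n}(t) +
∫₀ᵗ k_{i,n}(t-s) quadTerm(Y)_{i,n}(s) ds`, `k_{i,n}(τ) = Re⟨e^{τΔ}ψ_{i,n}, ψ_{i,n}⟩`. There is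
`δ = δ(ε₀, α) > 0` such that if at some time `t₀ < S` the band-Duhamel majorant
`b_{i,n}(t₀) = e^{-4π²(1+ε₀)^{2n}t₀}|A|1 + ∫₀^{t₀} |quadTerm_{i,n}(s)| e^{-4π²(1+ε₀)^{2n}(t₀-s)} ds` is small
in the scale-critical weight, `sup_{i,n} (1+ε₀)^{n/2} b_{i,n}(t₀) ≤ δ`, then the solution extends to every
`[0,S'')` (dissipation wins at every scale): `dieGlobal_of_kernel` for the heat kernels of the modes,
which are continuous with `0 ≤ k_{i,n}(τ) ≤ e^{-4π²(1+ε₀)^{2n}τ}` (`τ ≥ 0`) and `|k_{i,n}| ≤ 1`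
(`stub_kernel`). [cite: Tao2016AveragedNS, §4 p. 22 (4.14) and §5.2 Prop. 5.1] -/
theorem stub_dieGlobal :
    ∀ {ε₀ : ℝ}, 0 < ε₀ → ε₀ ≤ 1 → ∀ {m : ℕ} (𝒟 : CascadeWaveletData ε₀ m)
      (α : Fin m → Fin m → Fin m → ℤ × ℤ × ℤ → ℝ) (n₀ : ℤ), ∃ δ : ℝ, 0 < δ ∧
      ∀ (i₀ : Fin m) (A S : ℝ) (Y : Fin m → ℤ → ℝ → ℝ), 0 < S →
      (∀ i n, ContinuousOn (Y i n) (Ico 0 S)) →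
      (∀ i n t, n < n₀ → Y i n t = 0) →
      (∀ S' : ℝ, S' < S → ∃ C : ℝ, ∀ (i : Fin m) (n : ℤ), ∀ t ∈ Icc 0 S',
        (1 + ε₀) ^ ((20 : ℝ) * n) * |Y i n t| ≤ C) →
      (∀ (i : Fin m) (n : ℤ), ∀ t ∈ Ico 0 S,
        Y i n t = (if i = i₀ ∧ n = n₀ then A else 0) *
            (pairing (heat t (cascadeWavelet ε₀ (𝒟.ψ i) n)) (cascadeWavelet ε₀ (𝒟.ψ i) n)).re +
          ∫ s in (0 : ℝ)..t,
            (pairing (heat (t - s) (cascadeWavelet ε₀ (𝒟.ψ i) n)) (cascadeWavelet ε₀ (𝒟.ψ i) n)).re *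
              quadTerm ε₀ α Y i n s) →
      (∃ t₀ ∈ Ico 0 S, ∀ (i : Fin m) (n : ℤ),
        (1 + ε₀) ^ ((n : ℝ) / 2) *
          (Real.exp (-(4 * Real.pi ^ 2 * (1 + ε₀) ^ (2 * n) * t₀)) * (if i = i₀ ∧ n = n₀ then |A| else 0) +
            ∫ s in (0 : ℝ)..t₀, |quadTerm ε₀ α Y i n s| *
              Real.exp (-(4 * Real.pi ^ 2 * (1 + ε₀) ^ (2 * n) * (t₀ - s)))) ≤ δ) →
      ∀ S'' : ℝ, S ≤ S'' → ∃ Y'' : Fin m → ℤ → ℝ → ℝ,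
        (∀ i n, ContinuousOn (Y'' i n) (Ico 0 S'')) ∧
        (∀ i n t, n < n₀ → Y'' i n t = 0) ∧
        (∀ S' : ℝ, S' < S'' → ∃ C : ℝ, ∀ (i : Fin m) (n : ℤ), ∀ t ∈ Icc 0 S',
          (1 + ε₀) ^ ((20 : ℝ) * n) * |Y'' i n t| ≤ C) ∧
        (∀ (i : Fin m) (n : ℤ), ∀ t ∈ Ico 0 S'',
          Y'' i n t = (if i = i₀ ∧ n = n₀ then A else 0) *
              (pairing (heat t (cascadeWavelet ε₀ (𝒟.ψ i) n)) (cascadeWavelet ε₀ (𝒟.ψ i) n)).re +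
            ∫ s in (0 : ℝ)..t,
              (pairing (heat (t - s) (cascadeWavelet ε₀ (𝒟.ψ i) n)) (cascadeWavelet ε₀ (𝒟.ψ i) n)).re *
                quadTerm ε₀ α Y'' i n s) ∧
        ∀ (i : Fin m) (n : ℤ), ∀ t ∈ Ico 0 S, Y'' i n t = Y i n t := by
  intro ε₀ hε₀ hε₁ m 𝒟 α n₀
  exact dieGlobal_of_kernel hε₀ hε₁ α
    (fun i n τ => (pairing (heat τ (cascadeWavelet ε₀ (𝒟.ψ i) n)) (cascadeWavelet ε₀ (𝒟.ψ i) n)).re)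
    (fun i n τ hτ => (Real.exp_pos _).le.trans ((stub_kernel hε₀ hε₁ 𝒟 i n).2.1 τ hτ).1)
    (fun i n τ hτ => ((stub_kernel hε₀ hε₁ 𝒟 i n).2.1 τ hτ).2)
    (fun i n τ => abs_re_pairing_heat_cascadeWavelet_le hε₀ 𝒟 i n τ)
    (fun i n => continuous_re_pairing_heat_cascadeWavelet 𝒟 i n) n₀

end Summit.NavierStokesRegularity.NavierStokesRegularity.Theorems.PerpetualPumpAveragedTypeIBlowup

end
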